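import Summits.BirchSwinnertonDyer.BirchSwinnertonDyer.Theorems.ResidualThetaTransportAtTwoSignedMuSeedAtTwoPlusLayerRank
import Summits.BirchSwinnertonDyer.Rank1Residual.X5.TwoAdicTargetsTowerGapEnd
import Literature.NumberTheory.EllipticCurves.IwasawaEulerCharDualityProofs
import Literature.NumberTheory.EllipticCurves.Kobayashi2003.SignedSelmerModuleFiniteProofs
import HarnessLib

/-!
# Seed crux `SignedMuSeedAtTwoPlus` (stmt-BirchSwinnertonDyer-21438; = `stub_residualSeedAtTwo` of line `birth` of Kμ⁺
# stmt-BirchSwinnertonDyer-20689): the LAYER DUALITY DICTIONARY `#(X/(p,T^q)X) = #Sel^ε_∞[p, (γ−1)^q]` and the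
# finite-layer `μ`-certificate in Selmer currency

Cell `bsd-wall`, width seat `bsd-wall-rtt-p4-w3` (g3). THEOREMS ONLY (no `def`, no named fact, no `sorry`); helper
`--supports` the seed crux; nothing about any curve is asserted; BSD is not proved by this.

Both crux-ideate lines of the seed crux (`layer-rank-certificate`, stub S2 `LayerFixedDual`; `fukuda-step`, stub 2
`FinitenessTransport`) need the same piece of Pontryagin duality: for a dual pair `X ≅ Hom(S, ℚ/ℤ)` with `T` acting as
`ψ` (tree `IwasawaDual.IsDualPair`, e.g. `X = X^ε(E/K_∞)`, `S = Sel^ε(E/K_∞)`, `ψ = conj_γ − 1`,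
`SignedSelmerDualData.isDualPair`), the residual layer quotient `X/(p, T^q)X` is the character group of
`S[p, ψ^q] = {s : p s = 0, ψ^q s = 0}`. The tree has the cases `(T)` (`IsDualPair.exists_coinvariants_addEquiv`) and
`(p, T)` (`IsDualPair.mem_mPow_one_of_mem_annPiece`); this file does `(p, T^q)` by the same device (a character
killing `ker(s ↦ (p s, ψ^q s))` extends from the image in `S × S` to `S × S`, `ℚ/ℤ` being injective):

* §1 `eval_eq_zero_of_mem_layer` (`(p,T^q)X` kills `S[p, ψ^q]`), `mem_layer_of_forall_eval_eq_zero` (conversely),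
  `exists_quotient_layer_addEquiv` (`X/(p,T^q)X ≃ Hom(S[p,ψ^q], ℚ/ℤ)`), **`natCard_quotient_layer_eq`
  (`#(X/(p,T^q)X) = #S[p, ψ^q]`)**, `finite_quotient_layer_iff`.
* §2 signed Selmer data: `natCard_quotient_layer_eq_signed`; **`layerFixedDual`** = stub S2 `LayerFixedDual` of
  `Cruxes/SignedMuSeedAtTwoPlus/Lines/layer_rank_certificate.lean` VERBATIM (`layerIdeal` unfolded);
  **`isTorsion_and_mu_eq_zero_of_card_fixed_lt`** — the COMPLETE finite-layer certificate in Selmer currency: for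
  `E/K` elliptic, a `ℤ_p`-extension `κ` with topological generator `γ`, a sign `ε`, a datum `D` and layers `a ≤ b`,
  `#Sel^ε_∞[p,(γ−1)^b] < p^{b−a} · #Sel^ε_∞[p,(γ−1)^a]` ⟹ `X^ε` is `Λ`-torsion with `μ^ε = 0` (dictionary + tower-gap
  lemma `TowerGap.finite_modP_of_card_quotient_lt` via this seat's `LayerRank` adapter + `TowerGap.isTorsion_and_mu_eq_zero_of_finite_modP`;
  `X^ε` is finitely generated by `SignedSelmerDualData.moduleFinite`). What remains for a per-class certificate of the
  seed is CONTROL: identifying `Sel^ε_∞[p,(γ−1)^{q}]` with a finite-layer Selmer count (stubs S3/S4 of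
  `layer-rank-certificate`, the HONDA⁺ neighbourhood) — not touched here.

References: [GreenbergLNM1716] R. Greenberg, LNM 1716 (1999) §1 pp. 60, 65; [Kobayashi2003] S. Kobayashi, Invent. Math.
152 (2003) Def. 1.1, Thm. 1.2; [Fukuda1994] T. Fukuda, Proc. Japan Acad. 70 (1994) Thm. 1; [Washington1997] §13.2–13.3.
-/

set_option autoImplicit false
set_option linter.dupNamespace false

noncomputable section

open scoped Classical

open Literature.NumberTheory.EllipticCurves Literature.NumberTheory.EllipticCurves.IwasawaAlgebra
  Literature.NumberTheory.EllipticCurves.IwasawaDual Literature.NumberTheory.EllipticCurves.PontryaginCard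

namespace Summit.BirchSwinnertonDyer.BirchSwinnertonDyer.Theorems.SignedMuAtTwo.LayerDual

universe u

/-! ## §1. Generic dual pairs: `X/(p, T^q)X ≅ Hom(S[p, ψ^q], ℚ/ℤ)` -/

section Generic

variable {p : ℕ} [Fact p.Prime]
variable {S : Type*} [AddCommGroup S] {ψ : AddMonoid.End S}
variable {X : Type*} [AddCommGroup X] [Module (PowerSeries ℤ_[p]) X]
variable {toDual : X →+ (S →+ AddCircle (1 : ℚ))}

/-- In a dual pair, `C p • x = p • x` evaluates as `toDual (C p • x) s = toDual x (p • s)`. [folklore] -/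
theorem eval_C_p_smul (x : X) (s : S) :
    toDual ((PowerSeries.C (p : ℤ_[p]) : PowerSeries ℤ_[p]) • x) s = toDual x (p • s) := by
  rw [map_natCast, Nat.cast_smul_eq_nsmul, nsmul_eval]

/-- **`(p, T^q)X` kills `S[p, ψ^q]`**: for `x ∈ (p, T^q)X` and `s` with `p s = 0`, `ψ^q s = 0`: `toDual x s = 0`.
[cite: GreenbergLNM1716, §1 p. 60] -/
theorem eval_eq_zero_of_mem_layer (h : IsDualPair p ψ toDual) (q : ℕ) {x : X}
    (hx : x ∈ (Ideal.span {(PowerSeries.C (p : ℤ_[p]) : PowerSeries ℤ_[p]), PowerSeries.X ^ q} •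
      (⊤ : Submodule (PowerSeries ℤ_[p]) X)))
    {s : S} (hps : p • s = 0) (hψs : (ψ ^ q) s = 0) : toDual x s = 0 := by
  rw [Ideal.span_insert, Submodule.sup_smul, Submodule.ideal_span_singleton_smul,
    Submodule.ideal_span_singleton_smul, Submodule.mem_sup] at hx
  obtain ⟨y, hy, z, hz, rfl⟩ := hx
  rw [Submodule.mem_smul_pointwise_iff_exists] at hy hz
  obtain ⟨y', -, rfl⟩ := hy
  obtain ⟨z', -, rfl⟩ := hz
  rw [map_add, AddMonoidHom.add_apply, eval_C_p_smul, hps, map_zero, h.X_pow_smul, hψs, map_zero, add_zero]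

/-- **A character killing `S[p, ψ^q]` lies in `(p, T^q)X`** (exactness of Pontryagin duality at `X/(p,T^q)X`): it
factors through `S/S[p,ψ^q] ≅ δ(S) ⊆ S × S`, `δ s = (p s, ψ^q s)`, the induced character extends to `S × S` (injectivity
of `ℚ/ℤ`) as `(y₁, y₂)`, and `toDual x = y₁ ∘ p + y₂ ∘ ψ^q = toDual (p x₁ + T^q x₂)`. The case `q = 1` is the tree's
`IsDualPair.mem_mPow_one_of_mem_annPiece`. [cite: GreenbergLNM1716, §1 pp. 60, 65] -/
theorem mem_layer_of_forall_eval_eq_zero (h : IsDualPair p ψ toDual) (q : ℕ) {x : X}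
    (hx : ∀ s : S, p • s = 0 → (ψ ^ q) s = 0 → toDual x s = 0) :
    x ∈ (Ideal.span {(PowerSeries.C (p : ℤ_[p]) : PowerSeries ℤ_[p]), PowerSeries.X ^ q} •
      (⊤ : Submodule (PowerSeries ℤ_[p]) X)) := by
  -- `δ : S → S × S`, `s ↦ (p s, ψ^q s)`, with kernel `S[p, ψ^q]`
  let δ : S →+ S × S := (DistribSMul.toAddMonoidHom S (p : ℕ)).prod
    (AddMonoidHomClass.toAddMonoidHom (ψ ^ q))
  have hδ : ∀ s, δ s = (p • s, (ψ ^ q) s) := fun s ↦ rfl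
  have hker : δ.rangeRestrict.ker ≤ (toDual x).ker := by
    intro s hs
    rw [AddMonoidHom.mem_ker] at hs ⊢
    have hs' : δ s = 0 := congrArg (fun z : δ.range ↦ (z : S × S)) hs
    rw [hδ, Prod.mk_eq_zero] at hs'
    exact hx s hs'.1 hs'.2
  have hsurj : Function.Surjective δ.rangeRestrict := AddMonoidHom.rangeRestrict_surjective δ
  let χ' : δ.range →+ AddCircle (1 : ℚ) := δ.rangeRestrict.liftOfSurjective hsurj ⟨toDual x, hker⟩
  have hχ' : ∀ s, χ' (δ.rangeRestrict s) = toDual x s := fun s ↦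
    AddMonoidHom.liftOfRightInverse_comp_apply _ _ _ _ s
  obtain ⟨y, hy⟩ := CharacterModule.dual_surjective_of_injective
    (δ.range.subtype.toIntLinearMap) (fun a b hab ↦ Subtype.ext hab) χ'
  have hy' : ∀ g : δ.range, y g = χ' g := fun g ↦ by
    have := DFunLike.congr_fun hy g
    rw [CharacterModule.dual_apply] at this
    exact this
  let y₀ : S × S →+ AddCircle (1 : ℚ) := y
  let y₁ : S →+ AddCircle (1 : ℚ) := y₀.comp (AddMonoidHom.inl S S)
  let y₂ : S →+ AddCircle (1 : ℚ) := y₀.comp (AddMonoidHom.inr S S)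
  have hsplit : ∀ s, toDual x s = y₁ (p • s) + y₂ ((ψ ^ q) s) := by
    intro s
    have e1 : toDual x s = y₀ ((δ.rangeRestrict s : δ.range) : S × S) := by
      rw [← hχ' s, ← hy']
      rfl
    rw [e1]
    change y₀ (δ s) = y₀ (p • s, 0) + y₀ (0, (ψ ^ q) s)
    rw [← map_add, Prod.mk_add_mk, add_zero, zero_add, hδ]
  obtain ⟨x₁, hx₁⟩ := h.bijective.2 y₁
  obtain ⟨x₂, hx₂⟩ := h.bijective.2 y₂
  have hx12 : x = (PowerSeries.C (p : ℤ_[p]) : PowerSeries ℤ_[p]) • x₁ +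
      ((PowerSeries.X : PowerSeries ℤ_[p]) ^ q) • x₂ := by
    apply h.bijective.1
    ext s
    rw [map_add, AddMonoidHom.add_apply, eval_C_p_smul, h.X_pow_smul, hx₁, hx₂, hsplit]
  rw [hx12]
  exact Submodule.add_mem _ (Submodule.smul_mem_smul (Ideal.subset_span (by simp)) Submodule.mem_top)
    (Submodule.smul_mem_smul (Ideal.subset_span (by simp)) Submodule.mem_top)

/-- **`X/(p, T^q)X ≅ Hom(S[p, ψ^q], ℚ/ℤ)`** for a dual pair, by restriction of characters to the subgroup
`S[p, ψ^q] = {s : p s = 0, ψ^q s = 0}` (presented as any additive subgroup `K` with that membership): restriction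
kills `(p,T^q)X` (`eval_eq_zero_of_mem_layer`), is injective modulo it (`mem_layer_of_forall_eval_eq_zero`) and onto
(characters of `K ⊆ S` extend). [cite: GreenbergLNM1716, §1 pp. 60, 65] -/
theorem exists_quotient_layer_addEquiv (h : IsDualPair p ψ toDual) (q : ℕ) (K : AddSubgroup S)
    (hK : ∀ s, s ∈ K ↔ p • s = 0 ∧ (ψ ^ q) s = 0) :
    ∃ Ψ : (X ⧸ (Ideal.span {(PowerSeries.C (p : ℤ_[p]) : PowerSeries ℤ_[p]), PowerSeries.X ^ q} •
        (⊤ : Submodule (PowerSeries ℤ_[p]) X))) ≃+ CharacterModule K,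
      ∀ (x : X) (a : K), Ψ (Submodule.Quotient.mk x) a = toDual x a := by
  set N : Submodule (PowerSeries ℤ_[p]) X :=
    Ideal.span {(PowerSeries.C (p : ℤ_[p]) : PowerSeries ℤ_[p]), PowerSeries.X ^ q} • ⊤ with hN
  let R₀ : X →+ CharacterModule K :=
    { toFun := fun x ↦ (toDual x).comp K.subtype
      map_zero' := by rw [map_zero, AddMonoidHom.zero_comp]; rfl
      map_add' := fun x y ↦ by rw [map_add, AddMonoidHom.add_comp]; rfl }
  have hR₀ : ∀ (x : X) (a : K), R₀ x a = toDual x a := fun _ _ ↦ rfl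
  have hR₀N : ∀ x ∈ N, R₀ x = 0 := fun x hx ↦ by
    refine CharacterModule.ext (A := K) fun a ↦ ?_
    rw [hR₀, characterModule_zero_apply]
    exact eval_eq_zero_of_mem_layer h q hx ((hK a).mp a.2).1 ((hK a).mp a.2).2
  let R : (X ⧸ N) →+ CharacterModule K :=
    QuotientAddGroup.lift N.toAddSubgroup R₀ (fun m hm ↦ hR₀N m hm)
  have hRmk : ∀ x : X, R (Submodule.Quotient.mk x) = R₀ x := fun _ ↦ rfl
  have hRbij : Function.Bijective R := by
    constructor
    · rw [injective_iff_map_eq_zero]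
      intro z hz
      induction z using Submodule.Quotient.induction_on with
      | H x =>
        rw [hRmk] at hz
        have hx : ∀ s : S, p • s = 0 → (ψ ^ q) s = 0 → toDual x s = 0 := fun s hps hψs ↦ by
          have := DFunLike.congr_fun hz ⟨s, (hK s).mpr ⟨hps, hψs⟩⟩
          rwa [hR₀] at this
        exact (Submodule.Quotient.mk_eq_zero N).mpr (mem_layer_of_forall_eval_eq_zero h q hx)
    · intro χ
      obtain ⟨χ', hχ'⟩ := CharacterModule.dual_surjective_of_injective
        K.subtype.toIntLinearMap (fun a b hab ↦ Subtype.ext hab) χ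
      obtain ⟨x, hx⟩ := h.bijective.2 χ'
      refine ⟨Submodule.Quotient.mk x, ?_⟩
      rw [hRmk]
      refine CharacterModule.ext (A := K) fun a ↦ ?_
      rw [hR₀, hx, ← hχ']
      rfl
  exact ⟨AddEquiv.ofBijective R hRbij, fun x a ↦ rfl⟩

/-- **THE LAYER DUALITY COUNT: `#(X/(p, T^q)X) = #{s : p s = 0, ψ^q s = 0}`** for every dual pair and every `q`
(`Nat.card`; both sides are `0` when infinite). [cite: GreenbergLNM1716, §1 pp. 60, 65] [cite: Kobayashi2003, Thm. 1.2] -/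
theorem natCard_quotient_layer_eq (h : IsDualPair p ψ toDual) (q : ℕ) :
    Nat.card (X ⧸ (Ideal.span {(PowerSeries.C (p : ℤ_[p]) : PowerSeries ℤ_[p]), PowerSeries.X ^ q} •
        (⊤ : Submodule (PowerSeries ℤ_[p]) X))) =
      Nat.card {s : S // p • s = 0 ∧ (ψ ^ q) s = 0} := by
  let K : AddSubgroup S :=
    { carrier := {s | p • s = 0 ∧ (ψ ^ q) s = 0}
      zero_mem' := ⟨smul_zero _, map_zero _⟩
      add_mem' := fun {a b} ha hb ↦
        ⟨by rw [smul_add, ha.1, hb.1, add_zero], by rw [map_add, ha.2, hb.2, add_zero]⟩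
      neg_mem' := fun {a} ha ↦ ⟨by rw [smul_neg, ha.1, neg_zero], by rw [map_neg, ha.2, neg_zero]⟩ }
  obtain ⟨Ψ, -⟩ := exists_quotient_layer_addEquiv h q K (fun _ ↦ Iff.rfl)
  rw [natCard_eq_of_addEquiv_characterModule Ψ]
  exact Nat.card_congr (Equiv.refl _)

/-- `X/(p, T^q)X` is finite iff `{s : p s = 0, ψ^q s = 0}` is. [folklore] -/
theorem finite_quotient_layer_iff (h : IsDualPair p ψ toDual) (q : ℕ) :
    Finite (X ⧸ (Ideal.span {(PowerSeries.C (p : ℤ_[p]) : PowerSeries ℤ_[p]), PowerSeries.X ^ q} •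
        (⊤ : Submodule (PowerSeries ℤ_[p]) X))) ↔
      {s : S | p • s = 0 ∧ (ψ ^ q) s = 0}.Finite := by
  let K : AddSubgroup S :=
    { carrier := {s | p • s = 0 ∧ (ψ ^ q) s = 0}
      zero_mem' := ⟨smul_zero _, map_zero _⟩
      add_mem' := fun {a b} ha hb ↦
        ⟨by rw [smul_add, ha.1, hb.1, add_zero], by rw [map_add, ha.2, hb.2, add_zero]⟩
      neg_mem' := fun {a} ha ↦ ⟨by rw [smul_neg, ha.1, neg_zero], by rw [map_neg, ha.2, neg_zero]⟩ }
  obtain ⟨Ψ, -⟩ := exists_quotient_layer_addEquiv h q K (fun _ ↦ Iff.rfl)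
  rw [finite_iff_of_addEquiv_characterModule Ψ]
  exact Iff.symm Set.finite_coe_iff

end Generic

/-! ## §2. Signed Selmer data: the dictionary, stub S2 verbatim, and the certificate in Selmer currency -/

section Signed

variable {K : Type u} [Field K] [NumberField K] {W : WeierstrassCurve K} {p : ℕ} [Fact p.Prime]
  {κ : ZpExtension K p} {γ : Field.absoluteGaloisGroup K} {ε : ℤˣ}

open Literature.NumberTheory.EllipticCurves.Kobayashi2003

/-- **`#(X^ε/(p, T^q)X^ε) = #Sel^ε(E/K_∞)[p, (γ−1)^q]`** for every Pontryagin-dual datum `D` of the signed Selmer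
group at a topological generator `γ` (`SignedSelmerDualData.isDualPair`). [cite: Kobayashi2003, Def. 1.1, Thm. 1.2]
[cite: GreenbergLNM1716, §1 pp. 60, 65] -/
theorem natCard_quotient_layer_eq_signed (D : SignedSelmerDualData W κ γ ε) (hγ : κ.IsTopGenerator γ) (q : ℕ) :
    Nat.card (D.X ⧸ (Ideal.span {(PowerSeries.C (p : ℤ_[p]) : IwasawaAlgebra p), PowerSeries.X ^ q} •
        (⊤ : Submodule (IwasawaAlgebra p) D.X))) =
      Nat.card {s : signedSelmerInfty W κ ε // p • s = 0 ∧ ((conjSignedSelmerInfty W κ ε γ - 1) ^ q) s = 0} :=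
  natCard_quotient_layer_eq (D.isDualPair hγ) q

/-- **Stub S2 `stub_layerFixedDual` of line `layer-rank-certificate` (seed crux `SignedMuSeedAtTwoPlus`,
stmt-BirchSwinnertonDyer-21438) — its statement `LayerFixedDual` VERBATIM** (`layerIdeal p q = Ideal.span {C p, T^q}`
unfolded): the layer-fixed dictionary as a `Finset` with `F.card = #(X/(p,T^q)X)` (finite because `X` is finitely
generated, `TowerGap.finite_quotient_towerIdeal`). [cite: Kobayashi2003, Thm. 1.2] [cite: GreenbergLNM1716, §1 p. 60] -/
theorem layerFixedDual :
    ∀ {K : Type} [Field K] [NumberField K] (W : WeierstrassCurve K) {p : ℕ} [Fact p.Prime]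
      (κ : ZpExtension K p) (γ : Field.absoluteGaloisGroup K) (ε : ℤˣ), κ.IsTopGenerator γ →
      ∀ (D : SignedSelmerDualData W κ γ ε) [Module.Finite (IwasawaAlgebra p) D.X] (q : ℕ),
        ∃ F : Finset (signedSelmerInfty W κ ε),
          (∀ s, s ∈ F ↔ (p • s = 0 ∧ ((conjSignedSelmerInfty W κ ε γ - 1) ^ q) s = 0)) ∧
          F.card = Nat.card (D.X ⧸ (Ideal.span {PowerSeries.C (p : ℤ_[p]), (PowerSeries.X : IwasawaAlgebra p) ^ q} •
            (⊤ : Submodule (IwasawaAlgebra p) D.X))) := by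
  intro K _ _ W p _ κ γ ε hγ D _ q
  have hfinQ : Finite (D.X ⧸ (Ideal.span {PowerSeries.C (p : ℤ_[p]), (PowerSeries.X : IwasawaAlgebra p) ^ q} •
      (⊤ : Submodule (IwasawaAlgebra p) D.X))) := by
    rw [← Summit.BirchSwinnertonDyer.Rank1Residual.X5.TowerGap.towerIdeal_eq_span_pair]
    exact Summit.BirchSwinnertonDyer.Rank1Residual.X5.TowerGap.finite_quotient_towerIdeal p q
  have hfinS : {s : signedSelmerInfty W κ ε | p • s = 0 ∧ ((conjSignedSelmerInfty W κ ε γ - 1) ^ q) s = 0}.Finite :=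
    (finite_quotient_layer_iff (D.isDualPair hγ) q).mp hfinQ
  refine ⟨hfinS.toFinset, fun s ↦ by rw [Set.Finite.mem_toFinset]; rfl, ?_⟩
  rw [natCard_quotient_layer_eq (D.isDualPair hγ) q, ← Set.ncard_eq_toFinset_card _ hfinS,
    ← Nat.card_coe_set_eq]
  rfl

/-- **THE FINITE-LAYER `μ`-CERTIFICATE IN SELMER CURRENCY.** Let `E/K` be an elliptic curve over a number field,
`κ` a `ℤ_p`-extension with topological generator `γ`, `ε` a sign and `D` a Pontryagin-dual datum of `Sel^ε(E/K_∞)`.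
If for two layers `a ≤ b`
`#{s ∈ Sel^ε_∞ : p s = 0, (γ−1)^b s = 0} < p^{b−a} · #{s ∈ Sel^ε_∞ : p s = 0, (γ−1)^a s = 0}`,
then `X^ε(E/K_∞)` is `Λ`-torsion with `μ^ε = 0`. Dictionary (`natCard_quotient_layer_eq_signed`) + tower-gap lemma
(`LayerRank.finite_quotient_augIdealP_of_card_layer_lt` over `TowerGap.finite_modP_of_card_quotient_lt`) +
`TowerGap.isTorsion_and_mu_eq_zero_of_finite_modP`; `X^ε` is finitely generated by `SignedSelmerDualData.moduleFinite`.
No reduction type, no sign, no prime is special; what a per-class use still needs is CONTROL (the finite-layer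
meaning of the two counts). [cite: Fukuda1994, Thm. 1] [cite: Kobayashi2003, Thm. 1.2] [cite: Washington1997, §13.2–13.3] -/
theorem isTorsion_and_mu_eq_zero_of_card_fixed_lt [W.IsElliptic] (D : SignedSelmerDualData W κ γ ε)
    (hγ : κ.IsTopGenerator γ) {a b : ℕ} (hab : a ≤ b)
    (h : Nat.card {s : signedSelmerInfty W κ ε // p • s = 0 ∧ ((conjSignedSelmerInfty W κ ε γ - 1) ^ b) s = 0} <
      p ^ (b - a) *
        Nat.card {s : signedSelmerInfty W κ ε // p • s = 0 ∧ ((conjSignedSelmerInfty W κ ε γ - 1) ^ a) s = 0}) :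
    Module.IsTorsion (IwasawaAlgebra p) D.X ∧ D.mu = 0 := by
  haveI : Module.Finite (IwasawaAlgebra p) D.X := SignedSelmerDualData.moduleFinite hγ D
  rw [← natCard_quotient_layer_eq_signed D hγ b, ← natCard_quotient_layer_eq_signed D hγ a] at h
  exact Summit.BirchSwinnertonDyer.Rank1Residual.X5.TowerGap.isTorsion_and_mu_eq_zero_of_finite_modP p
    (LayerRank.finite_quotient_augIdealP_of_card_layer_lt p D.X hab h)

end Signed

end Summit.BirchSwinnertonDyer.BirchSwinnertonDyer.Theorems.SignedMuAtTwo.LayerDual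

end
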